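import Summits.AtomisticToContinuum.HydrodynamicLimit.Theorems.EnskogAdjointDualityDualityReductionMaxwellian
import HarnessLib

/-!
# Velocity equilibration at rung 0 (stub S3b `stub_velocityEquilibrationRung0` of the line
# `preshock-kinetic-slaving`, crux `JParityClosure.EvenStressEnskog`, stmt-AtomisticToContinuum-13079)
# — helper 1: continuity of the local-Maxwellian pairing in its parameters

For a continuous test function `F(v, u, θ)` of quadratic growth
`|F(v, u, θ)| ≤ C (1 + ‖v‖² + ‖u‖² + |θ|)` the local-Maxwellian pairing
`(u', θ') ↦ ∫ F(v, u', θ') M_{1,θ',u'}(v) dv` is continuous at every `(u, θ)` with `θ > 0`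
(`continuousAt_integral_mul_localMaxwellian`).  Proof: on the open half-space `{θ' > 0}` the pairing
is the standard-Gaussian integral `∫ F(u' + √θ' w, u', θ') dN(0, id)(w)`
(`integral_localMaxwellian_mul_eq_integral_gaussMeasure`, `integral_gaussMeasure`), to which dominated
convergence (`continuousAt_of_dominated`) applies with the quadratic majorant
`C (1 + 3U² + Θ + 2Θ‖w‖²)` on the neighbourhood `‖u'‖ ≤ U = ‖u‖ + 1`, `|θ'| ≤ Θ = θ + 1`.
This is the plug-in continuity used by the rung-0 one-body law of large numbers (`u_r → u`,
`θ_r → θ` in probability transports through the Maxwellian prediction `oneBodyPred`).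

References: standard (dominated convergence); H. Spohn, *Large Scale Dynamics of Interacting
Particles* (1991), Part I §2.3 for the setting.
-/

noncomputable section

open MeasureTheory ProbabilityTheory Filter Set Topology
open scoped ENNReal InnerProductSpace BigOperators

namespace Summit.AtomisticToContinuum.HydrodynamicLimit.Theorems.EvenStressEnskog

open Literature.Analysis.FluidPDE Literature.MathematicalPhysics.KineticTheory

/-- `‖a + c • w‖² ≤ 2‖a‖² + 2c²‖w‖²`. [folklore] -/
theorem norm_add_smul_sq_le (a w : V3) (c : ℝ) :
    ‖a + c • w‖ ^ 2 ≤ 2 * ‖a‖ ^ 2 + 2 * c ^ 2 * ‖w‖ ^ 2 := by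
  have h1 : ‖a + c • w‖ ≤ ‖a‖ + |c| * ‖w‖ := by
    calc ‖a + c • w‖ ≤ ‖a‖ + ‖c • w‖ := norm_add_le _ _
      _ = ‖a‖ + |c| * ‖w‖ := by rw [norm_smul, Real.norm_eq_abs]
  have h2 : ‖a + c • w‖ ^ 2 ≤ (‖a‖ + |c| * ‖w‖) ^ 2 := pow_le_pow_left₀ (norm_nonneg _) h1 2
  have h3 : (‖a‖ + |c| * ‖w‖) ^ 2 ≤ 2 * ‖a‖ ^ 2 + 2 * (|c| * ‖w‖) ^ 2 := by
    nlinarith [sq_nonneg (‖a‖ - |c| * ‖w‖)]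
  rw [mul_pow, sq_abs] at h3
  linarith

/-- `(√t)² ≤ |t|` for every real `t` (`= t` for `t ≥ 0`, `= 0` otherwise). [folklore] -/
theorem sq_sqrt_le_abs (t : ℝ) : Real.sqrt t ^ 2 ≤ |t| := by
  rcases le_or_gt 0 t with ht | ht
  · rw [Real.sq_sqrt ht]; exact le_abs_self t
  · rw [Real.sqrt_eq_zero'.2 ht.le]; simp

/-- **Continuity of the local-Maxwellian pairing in its parameters** (registered sub-goal of
`stub_velocityEquilibrationRung0`): for a continuous `F` with
`|F(v,u,θ)| ≤ C(1 + ‖v‖² + ‖u‖² + |θ|)` and `θ > 0`,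
`(u', θ') ↦ ∫ F(v, u', θ') M_{1,θ',u'}(v) dv` is continuous at `(u, θ)`. [folklore] -/
theorem continuousAt_integral_mul_localMaxwellian :
    ∀ {F : V3 × V3 × ℝ → ℝ}, Continuous F →
    (∃ C : ℝ, ∀ q, |F q| ≤ C * (1 + ‖q.1‖ ^ 2 + ‖q.2.1‖ ^ 2 + |q.2.2|)) →
    ∀ (u : V3) {θ : ℝ}, 0 < θ →
      ContinuousAt (fun p : V3 × ℝ => ∫ v, F (v, p.1, p.2) * localMaxwellian 1 p.2 p.1 v) (u, θ) := by
  intro F hF hC u θ hθ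
  obtain ⟨C, hC⟩ := hC
  have hC0 : 0 ≤ C := by
    have h := hC ((0 : V3), (0 : V3), (0 : ℝ))
    simp only [norm_zero, abs_zero] at h
    have : (0 : ℝ) ≤ C * (1 + 0 ^ 2 + 0 ^ 2 + 0) := (abs_nonneg _).trans h
    linarith
  -- on `{θ' > 0}` the pairing is a standard-Gaussian integral
  have heq : (fun p : V3 × ℝ => ∫ w, F (p.1 + Real.sqrt p.2 • w, p.1, p.2) ∂stdGaussian V3) =ᶠ[𝓝 (u, θ)]
      fun p : V3 × ℝ => ∫ v, F (v, p.1, p.2) * localMaxwellian 1 p.2 p.1 v := by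
    have hopen : IsOpen {p : V3 × ℝ | 0 < p.2} := isOpen_lt continuous_const continuous_snd
    filter_upwards [hopen.mem_nhds (show (u, θ) ∈ {p : V3 × ℝ | 0 < p.2} from hθ)] with p hp
    have hp' : 0 < p.2 := hp
    rw [← integral_gaussMeasure p.1 hp' (fun v => F (v, p.1, p.2)),
      ← integral_localMaxwellian_mul_eq_integral_gaussMeasure hp' p.1]
    exact integral_congr_ae (ae_of_all _ fun v => mul_comm _ _)
  refine ContinuousAt.congr ?_ heq
  -- dominated convergence on the neighbourhood `‖u'‖ ≤ U`, `|θ'| ≤ Θ`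
  set U : ℝ := ‖u‖ + 1 with hU
  set Θ : ℝ := θ + 1 with hΘ
  have hsq : Integrable (fun w : V3 => ‖w‖ ^ 2) (stdGaussian V3) :=
    (IsGaussian.memLp_id _ 2 (by simp)).integrable_norm_pow (by norm_num)
  have hball : ∀ᶠ p : V3 × ℝ in 𝓝 (u, θ), ‖p.1‖ ≤ U ∧ |p.2| ≤ Θ := by
    have h1 : ∀ᶠ p : V3 × ℝ in 𝓝 (u, θ), dist p.1 u < 1 :=
      Metric.tendsto_nhds.1 ((continuous_fst (X := V3) (Y := ℝ)).tendsto (u, θ)) 1 one_pos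
    have h2 : ∀ᶠ p : V3 × ℝ in 𝓝 (u, θ), dist p.2 θ < 1 :=
      Metric.tendsto_nhds.1 ((continuous_snd (X := V3) (Y := ℝ)).tendsto (u, θ)) 1 one_pos
    filter_upwards [h1, h2] with p hp1 hp2
    rw [dist_eq_norm] at hp1
    rw [Real.dist_eq] at hp2
    constructor
    · calc ‖p.1‖ = ‖(p.1 - u) + u‖ := by rw [sub_add_cancel]
        _ ≤ ‖p.1 - u‖ + ‖u‖ := norm_add_le _ _
        _ ≤ U := by rw [hU]; linarith
    · calc |p.2| = |(p.2 - θ) + θ| := by rw [sub_add_cancel]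
        _ ≤ |p.2 - θ| + |θ| := abs_add_le _ _
        _ ≤ Θ := by rw [hΘ, abs_of_pos hθ]; linarith
  refine continuousAt_of_dominated
    (bound := fun w : V3 => C * (1 + 3 * U ^ 2 + Θ + 2 * Θ * ‖w‖ ^ 2)) ?_ ?_ ?_ ?_
  · refine Eventually.of_forall fun p => Continuous.aestronglyMeasurable ?_
    have hc : Continuous fun w : V3 => (p.1 + Real.sqrt p.2 • w, p.1, p.2) := by fun_prop
    exact hF.comp hc
  · filter_upwards [hball] with p hp
    refine ae_of_all _ fun w => ?_
    rw [Real.norm_eq_abs]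
    refine (hC _).trans ?_
    dsimp only
    have h1 := norm_add_smul_sq_le p.1 w (Real.sqrt p.2)
    have h2 : Real.sqrt p.2 ^ 2 ≤ Θ := (sq_sqrt_le_abs p.2).trans hp.2
    have h3 : ‖p.1‖ ^ 2 ≤ U ^ 2 := pow_le_pow_left₀ (norm_nonneg _) hp.1 2
    have h4 : Real.sqrt p.2 ^ 2 * ‖w‖ ^ 2 ≤ Θ * ‖w‖ ^ 2 :=
      mul_le_mul_of_nonneg_right h2 (sq_nonneg _)
    refine mul_le_mul_of_nonneg_left ?_ hC0
    nlinarith [hp.2, sq_nonneg ‖w‖]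
  · exact ((integrable_const _).add (hsq.const_mul _)).const_mul _
  · refine Eventually.of_forall fun w => Continuous.continuousAt ?_
    have hc : Continuous fun p : V3 × ℝ => (p.1 + Real.sqrt p.2 • w, p.1, p.2) :=
      (continuous_fst.add ((Real.continuous_sqrt.comp continuous_snd).smul continuous_const)).prodMk
        (continuous_fst.prodMk continuous_snd)
    exact hF.comp hc

end Summit.AtomisticToContinuum.HydrodynamicLimit.Theorems.EvenStressEnskog

end
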